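import Summits.CriticalPhenomena.PercolationContinuityZ3.Theorems.PercNearOneGluingNoHeavyLowerTailSahiGridPatternRounding

/-!
# `NoHeavyLowerTail` (crux stmt-CriticalPhenomena-4575), Sahi programme P1: the rounding calculus, part 2 —
# **A DESCENT OWNED BY ONE SET IS LINEAR** (Lieb–Sahi 2022, Prop. 2.6, in every dimension of the Latin cube `[3]^d`)

Support file (seat `prim-sahi-p1`, generation 12; `--supports stmt-CriticalPhenomena-4575`).  Pure proofs; one bookkeeping definition
(`axSwapEquiv`, the value transposition on one axis as an equivalence); no `sorry`, standard axioms.  Vocabulary of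
`…SahiGridPatternRounding` (`axSwap`, `AxInv`, `lo`, `hi`, `roundUp`, `roundDown`) and `…SahiGridPatternAllDim` / `…TwoCylinders`
(`tcD`, `sStarD_eq_sum_tcD`, `tcD_valuePerm`).

THE MATHEMATICS.  `sStarD` is invariant under a value transposition on one axis applied to all three sets (`sStarD_image_axSwap`, from
`tcD_valuePerm`).  For an up-set `A` and the adjacent level pair `(lo, hi)` on axis `a`, the indicators satisfy
`1_{roundUp A} + 1_{roundDown A} = 1_A + 1_{(lo hi)·A}` pointwise (`ind_roundUp_add_roundDown`).  Hence, by trilinearity,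
**`sStarD_roundUp_add_roundDown`**: if `B` and `C` are `(lo hi)`-invariant on axis `a` then
`sStarD (roundUp a j A) B C + sStarD (roundDown a j A) B C = 2 · sStarD A B C`, and so (`min_sStarD_round_le`) one of the two roundings
of `A` alone does not increase the functional — Lieb–Sahi's Proposition 2.6 ("`E₃(a⁺,b,c) + E₃(a⁻,b,c) = 2E₃(a,b,c)` when `b, c` have no
descent at `i`") transplanted from decreasing sequences to up-sets of `[3]^d`.  Consequently the obligation `RoundingAlternative d` of part 1
is automatic on every axis where only one of the three sets has a descent at the chosen level pair; the open content is the SHARED descents.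
HONEST LABEL: nothing here asserts `PatternPos d` (`d ≥ 4`), Kahn's Conjecture 5 or Sahi's `C₃`. [this work]
-/

namespace Summit.CriticalPhenomena.PercolationContinuityZ3.Theorems.SahiGridPattern

open Finset
open scoped Classical

variable {d : ℕ}

/-! ### A descent owned by one set is linear (Lieb–Sahi's Prop. 2.6 in `[3]^d`) -/

/-- The value transposition on axis `a` as an involutive equivalence of `[3]^d`. [this work] -/
def axSwapEquiv (a : Fin d) (u v : Fin 3) : Pd d ≃ Pd d where
  toFun := axSwap a u v
  invFun := axSwap a u v
  left_inv := axSwap_axSwap a u v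
  right_inv := axSwap_axSwap a u v

/-- The pattern tensor is invariant under a value transposition on one axis applied to all three points. [this work] -/
theorem tcD_axSwap (a : Fin d) (u v : Fin 3) (p q r : Pd d) :
    tcD (axSwap a u v p) (axSwap a u v q) (axSwap a u v r) = tcD p q r := by
  have key := tcD_valuePerm (Function.update (fun _ : Fin d => (Equiv.refl (Fin 3) : Equiv.Perm (Fin 3))) a (Equiv.swap u v)) p q r
  have hx : ∀ x : Pd d, (fun b => (Function.update (fun _ : Fin d => (Equiv.refl (Fin 3) : Equiv.Perm (Fin 3))) a
      (Equiv.swap u v)) b (x b)) = axSwap a u v x := by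
    intro x; funext b
    by_cases hb : b = a
    · subst hb; rw [Function.update_self, axSwap_apply_self]
    · rw [Function.update_of_ne hb, axSwap_apply_ne hb]; rfl
  rw [hx p, hx q, hx r] at key
  exact key

/-- `sStarD` is invariant under a value transposition on one axis applied to all three sets. [this work] -/
theorem sStarD_image_axSwap (a : Fin d) (u v : Fin 3) (A B C : Finset (Pd d)) :
    sStarD (A.image (axSwap a u v)) (B.image (axSwap a u v)) (C.image (axSwap a u v)) = sStarD A B C := by
  have hinj : Function.Injective (axSwap a u v : Pd d → Pd d) := (axSwapEquiv a u v).injective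
  rw [sStarD_eq_sum_tcD, sStarD_eq_sum_tcD, Finset.sum_image fun x _ y _ h => hinj h]
  refine Finset.sum_congr rfl fun p _ => ?_
  rw [Finset.sum_image fun x _ y _ h => hinj h]
  refine Finset.sum_congr rfl fun q _ => ?_
  rw [Finset.sum_image fun x _ y _ h => hinj h]
  exact Finset.sum_congr rfl fun r _ => tcD_axSwap a u v p q r

/-- An invariant set is its own image under the transposition. [this work] -/
theorem image_axSwap_eq_of_axInv {a : Fin d} {u v : Fin 3} {X : Finset (Pd d)} (h : AxInv a u v X) :
    X.image (axSwap a u v) = X := by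
  ext y
  rw [Finset.mem_image]
  constructor
  · rintro ⟨x, hx, rfl⟩; exact (h x).1 hx
  · intro hy
    exact ⟨axSwap a u v y, (h y).1 hy, axSwap_axSwap a u v y⟩

/-- `sStarD` as a sum over all points of the first slot's indicator against the slice `Σ_{q∈B,r∈C} t_d(p,q,r)`. [this work] -/
theorem sStarD_eq_sum_ite (A B C : Finset (Pd d)) :
    sStarD A B C = ∑ p : Pd d, if p ∈ A then ∑ q ∈ B, ∑ r ∈ C, tcD p q r else 0 := by
  rw [sStarD_eq_sum_tcD, ← Finset.sum_filter]
  congr 1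
  ext p; simp

/-- Pointwise bookkeeping: `1_{roundUp} + 1_{roundDown} = 1_A + 1_{(lo hi)·A}`. [this work] -/
theorem ind_roundUp_add_roundDown {a : Fin d} {j : Fin 2} {A : Finset (Pd d)} (hA : IsUpperSet (A : Set (Pd d)))
    (x : Pd d) (t : ℤ) :
    ((if x ∈ roundUp a j A then t else 0) + if x ∈ roundDown a j A then t else 0) =
      (if x ∈ A then t else 0) + if x ∈ A.image (axSwap a (lo j) (hi j)) then t else 0 := by
  have himg : x ∈ A.image (axSwap a (lo j) (hi j)) ↔ axSwap a (lo j) (hi j) x ∈ A := by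
    rw [Finset.mem_image]
    constructor
    · rintro ⟨y, hy, rfl⟩; rw [axSwap_axSwap]; exact hy
    · intro hx; exact ⟨_, hx, axSwap_axSwap a (lo j) (hi j) x⟩
  by_cases h1 : x a = lo j
  · have hle : x ≤ Function.update x a (hi j) := le_update_hi_of_eq_lo h1
    have hne : ¬ x a = hi j := fun h => lo_ne_hi j (h1.symm.trans h)
    have hsA : x ∈ A.image (axSwap a (lo j) (hi j)) ↔ Function.update x a (hi j) ∈ A := by
      rw [himg, axSwap_eq_update_of_eq_left h1]
    have hrD : x ∈ roundDown a j A ↔ x ∈ A := by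
      rw [mem_roundDown]; exact ⟨fun h => h.1, fun h => ⟨h, fun h' => absurd h' hne⟩⟩
    by_cases hx : x ∈ A
    · have hx' : Function.update x a (hi j) ∈ A := hA hle hx
      have hrU : x ∈ roundUp a j A := mem_roundUp.2 (Or.inl hx)
      rw [if_pos hrU, if_pos (hrD.2 hx), if_pos hx, if_pos (hsA.2 hx')]
    · by_cases hx' : Function.update x a (hi j) ∈ A
      · have hrU : x ∈ roundUp a j A := mem_roundUp.2 (Or.inr ⟨h1, hx'⟩)
        rw [if_pos hrU, if_neg (fun h => hx (hrD.1 h)), if_neg hx, if_pos (hsA.2 hx')]; ring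
      · have hrU : x ∉ roundUp a j A := fun h => by
          rcases mem_roundUp.1 h with h | ⟨-, h⟩
          · exact hx h
          · exact hx' h
        rw [if_neg hrU, if_neg (fun h => hx (hrD.1 h)), if_neg hx, if_neg (fun h => hx' (hsA.1 h))]
  · by_cases h2 : x a = hi j
    · have hle : Function.update x a (lo j) ≤ x := update_lo_le_of_eq_hi h2
      have hsA : x ∈ A.image (axSwap a (lo j) (hi j)) ↔ Function.update x a (lo j) ∈ A := by
        rw [himg, axSwap_eq_update_of_eq_right h2]
      have hrU : x ∈ roundUp a j A ↔ x ∈ A := by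
        rw [mem_roundUp]; exact ⟨fun h => h.elim id fun h' => absurd h'.1 h1, Or.inl⟩
      have hrD : x ∈ roundDown a j A ↔ Function.update x a (lo j) ∈ A := by
        rw [mem_roundDown]; exact ⟨fun h => h.2 h2, fun h => ⟨hA hle h, fun _ => h⟩⟩
      by_cases hx' : Function.update x a (lo j) ∈ A
      · have hx : x ∈ A := hA hle hx'
        rw [if_pos (hrU.2 hx), if_pos (hrD.2 hx'), if_pos hx, if_pos (hsA.2 hx')]
      · by_cases hx : x ∈ A
        · rw [if_pos (hrU.2 hx), if_neg (fun h => hx' (hrD.1 h)), if_pos hx, if_neg (fun h => hx' (hsA.1 h))]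
        · rw [if_neg (fun h => hx (hrU.1 h)), if_neg (fun h => hx' (hrD.1 h)), if_neg hx, if_neg (fun h => hx' (hsA.1 h))]
    · have hsA : x ∈ A.image (axSwap a (lo j) (hi j)) ↔ x ∈ A := by rw [himg, axSwap_eq_self h1 h2]
      have hrU : x ∈ roundUp a j A ↔ x ∈ A := by
        rw [mem_roundUp]; exact ⟨fun h => h.elim id fun h' => absurd h'.1 h1, Or.inl⟩
      have hrD : x ∈ roundDown a j A ↔ x ∈ A := by
        rw [mem_roundDown]; exact ⟨fun h => h.1, fun h => ⟨h, fun h' => absurd h' h2⟩⟩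
      by_cases hx : x ∈ A
      · rw [if_pos (hrU.2 hx), if_pos (hrD.2 hx), if_pos hx, if_pos (hsA.2 hx)]
      · rw [if_neg (fun h => hx (hrU.1 h)), if_neg (fun h => hx (hrD.1 h)), if_neg hx, if_neg (fun h => hx (hsA.1 h))]

/-- **Single-owner descents are linear** (Lieb–Sahi 2022, Prop. 2.6, in every dimension of the Latin cube): if `B` and `C` are invariant
under the value transposition `(lo hi)` on axis `a`, then `sStarD (roundUp a j A) B C + sStarD (roundDown a j A) B C = 2·sStarD A B C`;
in particular one of the two roundings of `A` alone does not increase the functional. [this work] -/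
theorem sStarD_roundUp_add_roundDown (a : Fin d) (j : Fin 2) {A B C : Finset (Pd d)} (hA : IsUpperSet (A : Set (Pd d)))
    (hB : AxInv a (lo j) (hi j) B) (hC : AxInv a (lo j) (hi j) C) :
    sStarD (roundUp a j A) B C + sStarD (roundDown a j A) B C = 2 * sStarD A B C := by
  have hsym : sStarD (A.image (axSwap a (lo j) (hi j))) B C = sStarD A B C := by
    conv_lhs => rw [← image_axSwap_eq_of_axInv hB, ← image_axSwap_eq_of_axInv hC]
    exact sStarD_image_axSwap a (lo j) (hi j) A B C
  have h2 : 2 * sStarD A B C = sStarD A B C + sStarD (A.image (axSwap a (lo j) (hi j))) B C := by rw [hsym, two_mul]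
  rw [h2, sStarD_eq_sum_ite (roundUp a j A), sStarD_eq_sum_ite (roundDown a j A), sStarD_eq_sum_ite A,
    sStarD_eq_sum_ite (A.image _), ← Finset.sum_add_distrib, ← Finset.sum_add_distrib]
  exact Finset.sum_congr rfl fun x _ => ind_roundUp_add_roundDown hA x _

/-- Hence a descent owned by one set never obstructs: `min (sStarD (roundUp a j A) B C) (sStarD (roundDown a j A) B C) ≤ sStarD A B C`
when `B`, `C` are `(lo hi)`-invariant on axis `a`. [this work] -/
theorem min_sStarD_round_le (a : Fin d) (j : Fin 2) {A B C : Finset (Pd d)} (hA : IsUpperSet (A : Set (Pd d)))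
    (hB : AxInv a (lo j) (hi j) B) (hC : AxInv a (lo j) (hi j) C) :
    min (sStarD (roundUp a j A) B C) (sStarD (roundDown a j A) B C) ≤ sStarD A B C := by
  have h := sStarD_roundUp_add_roundDown a j hA hB hC
  rcases le_total (sStarD (roundUp a j A) B C) (sStarD (roundDown a j A) B C) with hle | hle
  · rw [min_eq_left hle]; linarith
  · rw [min_eq_right hle]; linarith

end Summit.CriticalPhenomena.PercolationContinuityZ3.Theorems.SahiGridPattern
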